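import Summits.BirchSwinnertonDyer.Rank1Residual.X11b.BDPRouteShaAn
import HarnessLib

/-!
# Class X11b (any `p`): the EXACT Gross–Zagier shape of the analytic order of `Ш` —
# `#Ш(E)_an = (8 t_W² / (n m t_K² c² w² q_d |u| c_W)) · [E(K) : ℤP_K]²` (cell `b2b-bsdres`, team x11b3, S26)

HONEST FRAMING (cell `b2b-bsdres`, run/shared/lean/b2b/bsd-rank1-residual/, verbatim in every
file): the goal of the cell is to DELETE the COMBINATION-SHAPED residual classes of the
Birch–Swinnerton-Dyer formula for ALL analytic-rank `≤ 1` elliptic curves over `ℚ` — assembled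
STRICTLY from published theorems — so that the rank-`≤ 1` remainder becomes exactly the
CONSTRUCTION-SHAPED classes, which are TYPED, NOT attempted. This is not "finishing BSD". Research
route; per pair; EVIDENCE road; nothing booked; NO label changes; no mark moves. THEOREMS ONLY
(no definition, no named fact, no `sorry`).

PROVENANCE: sub-target S26 'SHA-AN FROM GROSS–ZAGIER' of team x11b3 (lead GEN 7 rulings R8-4 (d),
R8-16, R8-22 (e), **R8-23 = GO**, owner seat `b2b-bsdres-x11b3-p2` gen. 4; scoping memo
`HOME/b2b-bsdres-x11b3-p2/S26-SCOPING.md`). CREDIT: the computation below is multr1-p2's (sub-cell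
`multr1-p2`, gen 3): it is lines 108–262 of the proof of
`X11b.exists_shaAn_padicVal_eq_of_heegner` (`X11b/BDPRouteShaAn.lean`; Jetchev–Skinner–Wan 2017,
(eq:gz for K′) made exact) VERBATIM, where the identity `#Ш(E)_an = q` is a `have` consumed by
`padicValRat` and never exported. This file only EXTRACTS it as a stand-alone, `p`-FREE statement
(the four `p`-adic side conditions `p ≠ 2`, `p ∤ c`, `p ∤ #𝓞_K^×`, `ord_p u = 0` of the host serve its
valuation step and are dropped; `Dt.c ≠ 0` replaces `p ∤ c`) and puts it in the currency
`s = R · I²` of p260907 (`X11b/RegMultShaAnDenominator.lean`), with the denominator of `R`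
controlled by per-pair data.

## What this file proves

* §0 `Rat.den_dvd_of_mul_natCast_eq_intCast`, `den_dvd_of_gzShape` — pure `ℚ`-arithmetic: for
  `R = 8 t_W² / (n m t_K² c² w² q_d |u| c_W)`, `m ∈ {1,4}`:
  `R.den ∣ n · 4 · t_K² · |c|² · w² · |num q_d| · |num u| · c_W`.
* §1 **`exists_shaAn_eq_mul_index_sq`**: for `W/ℚ` globally minimal of conductor `N` with
  `ord_{s=1} L(E,s) = 1`, `K` imaginary quadratic with the Heegner hypothesis for `N` and
  `L(E^{d_K},1) ≠ 0`, `P ∈ E(K)` the Heegner point of a parametrisation datum `Dt` (Manin constant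
  `c = Dt.c ≠ 0`), `Wd = Cd • W^{(d_K)}` a globally minimal model of the twist and `q_d ∈ ℚ` with
  `L(Wd,1)/Ω(Wd) = q_d` (a DATUM): for some `m ∈ {1,4}`,
  `#Ш(E)_an = 8 I² t_W² / (n m t_K² c² w² q_d |u| c_W)` (`I = [E(K):ℤP]`, `n = [E(ℝ):E(ℝ)⁰]`,
  `t_W = #E(ℚ)_tors`, `t_K = #E(K)_tors`, `w = #𝓞_K^×`, `u` the scaling of `Cd`, `c_W = ∏ c_ℓ`);
  binders = the host's PUBLISHED facts `gross_zagier`, `kolyvagin`, `rank_eq_analyticRank_of_analyticRank_le_one`,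
  `hasEntireLFunction_rat`.
  **`exists_shaAn_eq_mul_sq`**: the same as `∃ m R (I : ℤ), … ∧ shaAn W = R · I² ∧ R.den ∣ D` —
  p260907's `(hs, hR)` pair plus the radius datum.

WHAT THIS FILE DOES NOT DO: take valuations, conclude `BSD(E,p)`, touch any label, or decide the
admissibility (D-a″, referee A — UNANSWERED) of `q_d` / the Manin constant as certificate inputs;
only `c ≠ 0` is assumed (no `c = 1`, no cited bound). Per H46 every landed CONSUMER of the
`s = R · I²` currency (p255944 / p260907, tranche D) is a `p ≥ 5` statement; no consumer at `3` is
named or implied here. H45: nothing 'shrinks'; this is bookkeeping made citable.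

## References

* D. Jetchev, C. Skinner, X. Wan, *The Birch and Swinnerton-Dyer formula for elliptic curves of
  analytic rank one*, Camb. J. Math. 5 (2017), §7.4.1 (eq:gz for K′), §7.3.1 (eq:tamK).
  [JetchevSkinnerWan2017]
* B. H. Gross, D. B. Zagier, *Heegner points and derivatives of `L`-series*, Invent. Math. 84
  (1986), V.§2. [GrossZagier1986]
* G. Grigorov, A. Jorza, S. Patrikis, W. Stein, C. Tarniţă, *Computational verification of the
  Birch and Swinnerton-Dyer conjecture for individual elliptic curves*, Math. Comp. 78 (2009),
  §3.2–§3.5 and proof of Thm. 1.8 (p. 2398). [GrigorovJorzaPatrikisSteinTarnita2009]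
* R. L. Miller, *Proving the Birch and Swinnerton-Dyer conjecture for specific elliptic curves of
  analytic rank zero and one*, LMS J. Comput. Math. 14 (2011), §1, §4. [Miller2011LMS]
-/

noncomputable section

open scoped Classical

open WeierstrassCurve NumberField Literature.NumberTheory.EllipticCurves
  Literature.NumberTheory.EllipticCurves.ModularForms
  Literature.NumberTheory.EllipticCurves.Rank1Residual
  Literature.NumberTheory.EllipticCurves.KrizLi2019
  Literature.NumberTheory.QuadraticFields

namespace Summit.BirchSwinnertonDyer.Rank1Residual.X11b

/-! ### §0. Denominator arithmetic of the shape `R = 8 t_W² / (n m t_K² c² w² q_d |u| c_W)` -/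

/-- If `R · D` is an integer for a natural number `D ≠ 0` then `R.den ∣ D`. [folklore] -/
theorem Rat.den_dvd_of_mul_natCast_eq_intCast {R : ℚ} {D : ℕ} (hD : D ≠ 0) {z : ℤ}
    (h : R * (D : ℚ) = (z : ℚ)) : R.den ∣ D := by
  have hR : R = Rat.divInt z D := by
    rw [Rat.divInt_eq_div, ← h, Int.cast_natCast, mul_div_cancel_right₀ _ (by exact_mod_cast hD)]
  have := Rat.den_dvd z D
  rw [← hR] at this
  exact_mod_cast this

/-- **The denominator of the Gross–Zagier constant `R` is controlled by per-pair data**: for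
`R = 8 t_W² / (n m t_K² c² w² q_d |u| c_W)` with `m ∈ {1, 4}` and all data non-zero,
`R.den ∣ n · 4 · t_K² · |c|² · w² · |num q_d| · |num u| · c_W` — a bound computable WITHOUT knowing
`m` or the Heegner index (`R · D = ±(32/m) · t_W² · den q_d · den u ∈ ℤ`). Pure `ℚ`-arithmetic.
[folklore] -/
theorem den_dvd_of_gzShape {tW n m tK w cW : ℕ} {c : ℤ} {qd u : ℚ} (hm : m = 1 ∨ m = 4)
    (hn : n ≠ 0) (htK : tK ≠ 0) (hc : c ≠ 0) (hw : w ≠ 0) (hcW : cW ≠ 0) (hqd : qd ≠ 0)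
    (hu : u ≠ 0) :
    (8 * (tW : ℚ) ^ 2 / ((n : ℚ) * (m : ℚ) * (tK : ℚ) ^ 2 * (c : ℚ) ^ 2 * (w : ℚ) ^ 2 * qd * |u| *
        (cW : ℚ))).den ∣
      n * 4 * tK ^ 2 * c.natAbs ^ 2 * w ^ 2 * qd.num.natAbs * u.num.natAbs * cW := by
  set Nq := qd.num with hNq
  set Dq := qd.den with hDq
  set Nu := u.num with hNu
  set Du := u.den with hDu
  have hqd' : qd = (Nq : ℚ) / (Dq : ℚ) := (Rat.num_div_den qd).symm
  have hu' : |u| = |(Nu : ℚ)| / (Du : ℚ) := by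
    rw [Rat.abs_def, Rat.divInt_eq_div]; push_cast; rfl
  have hNq0 : Nq ≠ 0 := Rat.num_ne_zero.mpr hqd
  have hNu0 : Nu ≠ 0 := Rat.num_ne_zero.mpr hu
  have hDq0 : (Dq : ℚ) ≠ 0 := by exact_mod_cast qd.den_ne_zero
  have hDu0 : (Du : ℚ) ≠ 0 := by exact_mod_cast u.den_ne_zero
  -- the sign of `num q_d`
  obtain ⟨ε, hε, hNqabs⟩ : ∃ ε : ℚ, (ε = 1 ∨ ε = -1) ∧ |(Nq : ℚ)| = ε * Nq := by
    rcases le_or_gt 0 Nq with h | h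
    · exact ⟨1, Or.inl rfl, by rw [one_mul]; exact abs_of_nonneg (by exact_mod_cast h)⟩
    · exact ⟨-1, Or.inr rfl, by rw [neg_one_mul]; exact abs_of_neg (by exact_mod_cast h)⟩
  -- the integer `32 / m ∈ {32, 8}`
  obtain ⟨k, hk⟩ : ∃ k : ℤ, (k : ℚ) * (m : ℚ) = 32 := by
    rcases hm with rfl | rfl
    · exact ⟨32, by norm_num⟩
    · exact ⟨8, by norm_num⟩
  obtain ⟨e, he⟩ : ∃ e : ℤ, (e : ℚ) = ε := by
    rcases hε with rfl | rfl
    · exact ⟨1, by norm_num⟩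
    · exact ⟨-1, by norm_num⟩
  have hD : n * 4 * tK ^ 2 * c.natAbs ^ 2 * w ^ 2 * qd.num.natAbs * u.num.natAbs * cW ≠ 0 := by
    have hc' : c.natAbs ≠ 0 := Int.natAbs_ne_zero.mpr hc
    have h1 : qd.num.natAbs ≠ 0 := Int.natAbs_ne_zero.mpr hNq0
    have h2 : u.num.natAbs ≠ 0 := Int.natAbs_ne_zero.mpr hNu0
    positivity
  refine Rat.den_dvd_of_mul_natCast_eq_intCast hD
    (z := e * k * (tW : ℤ) ^ 2 * (Dq : ℤ) * (Du : ℤ)) ?_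
  have hm0 : (m : ℚ) ≠ 0 := by rcases hm with rfl | rfl <;> norm_num
  have hNq' : (Nq : ℚ) ≠ 0 := by exact_mod_cast hNq0
  have hNu' : |(Nu : ℚ)| ≠ 0 := abs_ne_zero.mpr (by exact_mod_cast hNu0)
  have hn' : (n : ℚ) ≠ 0 := by exact_mod_cast hn
  have htK' : (tK : ℚ) ≠ 0 := by exact_mod_cast htK
  have hc' : (c : ℚ) ≠ 0 := by exact_mod_cast hc
  have hw' : (w : ℚ) ≠ 0 := by exact_mod_cast hw
  have hcW' : (cW : ℚ) ≠ 0 := by exact_mod_cast hcW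
  have hk' : (k : ℚ) = 32 / (m : ℚ) := by rw [← hk, mul_div_cancel_right₀ _ hm0]
  rw [hu', hqd']
  push_cast
  simp only [Nat.cast_natAbs, Int.cast_abs, sq_abs]
  rw [hNqabs, hk']
  field_simp
  rw [← he]
  ring

/-- **The exact Gross–Zagier shape of `#Ш(E)_an` (p-free).** Data: `W/ℚ` globally minimal of
conductor `N` with `ord_{s=1} L(E,s) = 1`; `K` imaginary quadratic with the Heegner hypothesis for
`N` and `L(E^{d_K},1) ≠ 0`; `P ∈ E(K)` the Heegner point of a parametrisation datum `Dt` with Manin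
constant `c = Dt.c ≠ 0`; `Wd = Cd • W^{(d_K)}` a globally minimal model of the twist; `q_d` a
rational with `L(E^{d_K},1)/Ω(Wd) = q_d` (a DATUM). PUBLISHED inputs as binders: `hGZ` (Gross–Zagier
1986 / Cai–Shu–Tian 2014), `hKo` (Kolyvagin 1990 Thm. A), `hGZK` (Gross–Zagier–Kolyvagin over `ℚ`),
`hmod` (modularity). CONCLUSION: for some `m ∈ {1, 4}`,
`#Ш(E)_an = 8 · I² · t_W² / (n · m · t_K² · c² · w² · q_d · |u| · c_W)` EXACTLY, where
`I = [E(K) : ℤP]`, `t_W = #E(ℚ)_tors`, `t_K = #E(K)_tors`, `n = [E(ℝ):E(ℝ)⁰] ∈ {1,2}`,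
`w = #𝓞_K^×`, `u` the scaling of `Cd`, `c_W = ∏_ℓ c_ℓ(E)`. This is the identity computed INSIDE
`X11b.exists_shaAn_padicVal_eq_of_heegner` (`X11b/BDPRouteShaAn.lean`, multr1-p2; Jetchev–Skinner–Wan
2017 (eq:gz for K′) made exact) before valuations are taken — extracted verbatim, with the four
`p`-adic side conditions of that theorem (which serve only its valuation step) dropped.
[cite: JetchevSkinnerWan2017, §7.4.1 (eq:gz for K′), pp. 29–30] [cite: GrossZagier1986, V.§2]
[cite: GrigorovJorzaPatrikisSteinTarnita2009, §3.2–§3.5 and proof of Thm. 1.8 (p. 2398)] -/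
theorem exists_shaAn_eq_mul_index_sq
    (W : WeierstrassCurve ℚ) [W.IsElliptic] [W.IsGloballyMinimal]
    (N : ℕ) [NeZero N] (K : Type) [Field K] [NumberField K]
    (Dt : ModularParametrizationData W N) (H : HeegnerDatum N (NumberField.discr K)) (ι : K →+* ℂ)
    (P : (W.baseChange K).toAffine.Point)
    -- the published inputs (named facts of the tree)
    (hGZ : gross_zagier N W K) (hKo : kolyvagin N W K)
    (hGZK : rank_eq_analyticRank_of_analyticRank_le_one) (hmod : hasEntireLFunction_rat)
    -- the data
    (hK : IsImaginaryQuadratic K) (hHN : SatisfiesHeegnerHypothesis N K)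
    (hP : WeierstrassCurve.Affine.Point.map ι.toRatAlgHom P = heegnerPointComplex Dt H)
    (hc : Dt.c ≠ 0) (hr : W.analyticRank = 1)
    (hLt : (W.quadraticTwist (NumberField.discr K : ℚ)).entireLFunction 1 ≠ 0)
    (Wd : WeierstrassCurve ℚ) [Wd.IsElliptic] [Wd.IsGloballyMinimal] (Cd : VariableChange ℚ)
    (hWd : Cd • W.quadraticTwist (NumberField.discr K : ℚ) = Wd)
    (qd : ℚ) (hqd : Wd.entireLFunction 1 / (Wd.realPeriodRat : ℂ) = (qd : ℂ)) :
    ∃ m : ℕ, (m = 1 ∨ m = 4) ∧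
      shaAn W = ((8 * ((AddSubgroup.zmultiples P).index : ℚ) ^ 2 * (W.torsionOrder : ℚ) ^ 2 /
        (((W.baseChange ℝ).numRealComponents : ℚ) * (m : ℚ) * ((W.baseChange K).torsionOrder : ℚ) ^ 2 *
          (Dt.c : ℚ) ^ 2 * (Units.torsionOrder K : ℚ) ^ 2 * qd * |(Cd.u : ℚ)| *
          (W.tamagawaProduct : ℚ)) : ℚ) : ℂ) := by
  haveI hEK : (W.baseChange K).IsElliptic := isElliptic_baseChange' W K
  obtain ⟨h2, hKtc⟩ := hK
  haveI : IsTotallyComplex K := hKtc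
  have hD0 : (NumberField.discr K : ℚ) ≠ 0 := by exact_mod_cast NumberField.discr_ne_zero K
  haveI hEt : (W.quadraticTwist (NumberField.discr K : ℚ)).IsElliptic :=
    W.isElliptic_quadraticTwist hD0
  ---------------------------------------------------------------- `L`-values over `ℚ` and `K`
  have hL0 : W.entireLFunction 1 = 0 := entireLFunction_one_eq_zero_of_analyticRank_eq_one hr
  obtain ⟨hlead, hderiv⟩ := leadingLCoeff_eq_deriv_of_analyticRank_eq_one hr
  have hprod := lDerivEK_eq_deriv_mul W K hmod hL0
  have hLK : LDerivEK W K ≠ 0 := by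
    rw [hprod]; exact mul_ne_zero hderiv hLt
  ---------------------------------------------------------------- the Heegner point is non-torsion; Kolyvagin
  have hPH : IsHeegnerPoint N W K P := ⟨Dt, H, ι, hP⟩
  have hPinf : ¬ IsOfFinAddOrder P :=
    (lDerivEK_ne_zero_iff_not_isOfFinAddOrder W N K hGZ ⟨h2, hKtc⟩ hHN hPH).mp hLK
  obtain ⟨hrkK, -⟩ := hKo ⟨h2, hKtc⟩ hHN hPH hPinf
  ---------------------------------------------------------------- ranks of `W` and `Wd`
  have hrt : (W.quadraticTwist (NumberField.discr K : ℚ)).analyticRank = 0 :=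
    ((W.quadraticTwist _).analyticRank_eq_zero_iff_holds (hmod _)).2 hLt
  have hrd : Wd.analyticRank = 0 := by rw [← hWd, analyticRank_smul, hrt]
  have hr1 : W.analyticRank ≤ 1 := le_of_eq hr
  have hrQ : W.mordellWeilRank = 1 := by rw [(hGZK W hr1).1, hr]
  ---------------------------------------------------------------- heights and index (Kriz–Li §2)
  obtain ⟨m, hm, hheight⟩ :=
    exists_mul_canonicalHeight_eq_index_sq_mul_regulator W K h2 hrkK hrQ P hPinf
  ---------------------------------------------------------------- Gross–Zagier and the period
  have hLD := (hGZ ⟨h2, hKtc⟩ hHN) Dt H ι P hP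
  have hper := two_mul_covolume_div_sqrt_eq_bsdPeriod W K Dt h2
  have hΩ := W.realPeriod_mul_realPeriod_quadraticTwist_eq_mul_bsdPeriod K h2
  have hΩd : Wd.realPeriodRat =
      |((Cd.u : ℚ) : ℝ)| * (W.quadraticTwist (NumberField.discr K : ℚ)).realPeriodRat := by
    rw [← hWd]; exact realPeriodRat_smul_holds (W.quadraticTwist _) Cd
  have hLt' : (W.quadraticTwist (NumberField.discr K : ℚ)).entireLFunction = Wd.entireLFunction := by
    rw [← hWd, entireLFunction_smul]
  ---------------------------------------------------------------- the twist's `L`-value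
  have hΩdpos : 0 < Wd.realPeriodRat := Wd.realPeriodRat_pos_holds
  have hΩdC : (Wd.realPeriodRat : ℂ) ≠ 0 := by exact_mod_cast hΩdpos.ne'
  have hLd : Wd.entireLFunction 1 = (((qd : ℝ) * Wd.realPeriodRat : ℝ) : ℂ) := by
    have := (div_eq_iff hΩdC).mp hqd
    rw [this]; push_cast; ring
  have hLd1 : Wd.entireLFunction 1 ≠ 0 := by rw [← hLt']; exact hLt
  have hqd0 : qd ≠ 0 := by
    intro h0
    apply hLd1
    rw [hLd, h0]; simp
  ---------------------------------------------------------------- positivity of everything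
  have hΩW : 0 < W.realPeriodRat := W.realPeriodRat_pos_holds
  have hΩt : 0 < (W.quadraticTwist (NumberField.discr K : ℚ)).realPeriodRat :=
    (W.quadraticTwist _).realPeriodRat_pos_holds
  have hR : 0 < W.regulator := W.regulator_pos'
  have hcW : 0 < W.tamagawaProduct := W.tamagawaProduct_pos_holds
  have htW : 0 < W.torsionOrder := W.torsionOrder_pos_holds
  have htK : 0 < (W.baseChange K).torsionOrder := (W.baseChange K).torsionOrder_pos_holds
  have hcM : (Dt.c : ℚ) ≠ 0 := by exact_mod_cast hc
  have hw : 0 < Units.torsionOrder K := Units.torsionOrder_pos K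
  have huu : (Cd.u : ℚ) ≠ 0 := Cd.u.ne_zero
  have hm0 : 0 < m := by rcases hm with rfl | rfl <;> norm_num
  have hI0 : (AddSubgroup.zmultiples P).index ≠ 0 := by
    intro hI
    rw [hI] at hheight
    have h0 : (m : ℝ) * ((W.baseChange K).torsionOrder : ℝ) ^ 2 * P.canonicalHeight = 0 := by
      rw [hheight]; simp
    have hh0 : P.canonicalHeight = 0 := by
      rcases mul_eq_zero.mp h0 with h' | h'
      · rcases mul_eq_zero.mp h' with h'' | h''
        · exact absurd (by exact_mod_cast h'' : m = 0) hm0.ne'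
        · exact absurd (pow_eq_zero_iff two_ne_zero |>.mp h'') (by exact_mod_cast htK.ne')
      · exact h'
    exact hPinf ((Affine.Point.canonicalHeight_eq_zero_iff_holds P).mp hh0)
  set n := (W.baseChange ℝ).numRealComponents with hn_def
  have hn : n = 1 ∨ n = 2 := numRealComponents_eq_one_or W
  have hn0 : 0 < n := by rcases hn with h' | h' <;> omega
  ---------------------------------------------------------------- the rational number `q = #Ш_an`
  set I := (AddSubgroup.zmultiples P).index with hI_def
  set q : ℚ := 8 * (I : ℚ) ^ 2 * (W.torsionOrder : ℚ) ^ 2 /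
      ((n : ℚ) * (m : ℚ) * ((W.baseChange K).torsionOrder : ℚ) ^ 2 * (Dt.c : ℚ) ^ 2 *
        (Units.torsionOrder K : ℚ) ^ 2 * qd * |(Cd.u : ℚ)| * (W.tamagawaProduct : ℚ)) with hq_def
  refine ⟨m, hm, ?_⟩
  ---------------------------------------------------------------- real abbreviations
  set ΩW := W.realPeriodRat with hΩW_def
  set Ωt := (W.quadraticTwist (NumberField.discr K : ℚ)).realPeriodRat with hΩt_def
  set B := (W.baseChange K).bsdPeriod with hB_def
  set R := W.regulator with hR_def
  set hh := P.canonicalHeight with hhh_def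
  set tK := (W.baseChange K).torsionOrder with htK_def
  set tW := W.torsionOrder with htW_def
  set cW := W.tamagawaProduct with hcW_def
  set w := Units.torsionOrder K with hw_def
  set cM := Dt.c with hcM_def
  set u := (Cd.u : ℚ) with hu_def
  have hΩW' : ΩW = (W.baseChange ℝ).realPeriod := rfl
  have hΩt' : Ωt = ((W.quadraticTwist (NumberField.discr K : ℚ)).baseChange ℝ).realPeriod := rfl
  rw [← hΩW', ← hΩt'] at hΩ
  -- `B = ΩW Ωt / n`, `ĥ = 2 I² R / (m tK²)`, the Gross–Zagier constant `= 4 B / (c² w²)`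
  have hBeq : B = ΩW * Ωt / n := by
    rw [hΩ]; field_simp
  have hheq : hh = 2 * (I : ℝ) ^ 2 * R / ((m : ℝ) * (tK : ℝ) ^ 2) := by
    rw [← hheight]; field_simp
  have hGZc : 2 * ZLattice.covolume Dt.L.lattice /
        ((cM : ℝ) ^ 2 * ((w : ℝ) / 2) ^ 2 * √|(NumberField.discr K : ℝ)|) =
      4 * B / ((cM : ℝ) ^ 2 * (w : ℝ) ^ 2) := by
    rw [← hper]; field_simp; ring
  -- the `L`-values as real numbers
  have hLdr : Wd.entireLFunction 1 = (((qd : ℝ) * (|(u : ℝ)| * Ωt) : ℝ) : ℂ) := by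
    rw [hLd, hΩd]
  have hLdne : ((qd : ℝ) * (|(u : ℝ)| * Ωt) : ℝ) ≠ 0 := by
    have hu' : |(u : ℝ)| ≠ 0 := abs_ne_zero.mpr (by exact_mod_cast huu)
    have hqd' : (qd : ℝ) ≠ 0 := by exact_mod_cast hqd0
    exact mul_ne_zero hqd' (mul_ne_zero hu' hΩt.ne')
  set X : ℝ := (4 * B / ((cM : ℝ) ^ 2 * (w : ℝ) ^ 2) * hh) / ((qd : ℝ) * (|(u : ℝ)| * Ωt))
    with hX_def
  have hL1 : deriv W.entireLFunction 1 = ((X : ℝ) : ℂ) := by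
    have hne : ((((qd : ℝ) * (|(u : ℝ)| * Ωt) : ℝ)) : ℂ) ≠ 0 := by exact_mod_cast hLdne
    have key : deriv W.entireLFunction 1 * ((((qd : ℝ) * (|(u : ℝ)| * Ωt) : ℝ)) : ℂ) =
        ((4 * B / ((cM : ℝ) ^ 2 * (w : ℝ) ^ 2) * hh : ℝ) : ℂ) := by
      rw [← hLdr, ← hLt', ← hprod, hLD, hGZc]
    rw [hX_def, Complex.ofReal_div, ← key, mul_div_cancel_right₀ _ hne]
  have hshaAnR : shaAn W = ((X * (tW : ℝ) ^ 2 / (ΩW * (cW : ℝ) * R) : ℝ) : ℂ) := by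
    rw [shaAn_def, hlead, hL1]
    push_cast
    rfl
  have hXq : X * (tW : ℝ) ^ 2 / (ΩW * (cW : ℝ) * R) = (q : ℝ) := by
    have hn' : (n : ℝ) ≠ 0 := by exact_mod_cast hn0.ne'
    have hm' : (m : ℝ) ≠ 0 := by exact_mod_cast hm0.ne'
    have htK' : (tK : ℝ) ≠ 0 := by exact_mod_cast htK.ne'
    have htW' : (tW : ℝ) ≠ 0 := by exact_mod_cast htW.ne'
    have hcW' : (cW : ℝ) ≠ 0 := by exact_mod_cast hcW.ne'
    have hcM' : (cM : ℝ) ≠ 0 := by exact_mod_cast hc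
    have hw' : (w : ℝ) ≠ 0 := by exact_mod_cast hw.ne'
    have hu' : |(u : ℝ)| ≠ 0 := abs_ne_zero.mpr (by exact_mod_cast huu)
    have hI' : (I : ℝ) ≠ 0 := by exact_mod_cast hI0
    have hqd' : (qd : ℝ) ≠ 0 := by exact_mod_cast hqd0
    rw [hX_def, hheq, hBeq, hq_def]
    push_cast
    field_simp
    ring
  change shaAn W = ((q : ℚ) : ℂ)
  rw [hshaAnR, hXq]; norm_cast

/-- **S26 in p260907's currency (`s = R · I²`).** Under the hypotheses of
`exists_shaAn_eq_mul_index_sq`: `#Ш(E)_an = R · I²` with `I = [E(K):ℤP] ∈ ℤ` and the EXPLICIT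
rational `R = 8 t_W² / (n m t_K² c² w² q_d |u| c_W)` for some `m ∈ {1,4}` — the pair `(hs, hR)` of
`RegMult.bsdp_of_katoSurj_of_cert_of_shaAnBall_of_eq_mul_sq` (`X11b/RegMultShaAnDenominator.lean`)
— together with the DENOMINATOR CONTROL `R.den ∣ n · 4 · t_K² · |c|² · w² · |num q_d| · |num u| · c_W`
(`den_dvd_of_gzShape`), a bound computable per pair without knowing `I` or `m`. Nothing about
valuations or `BSD(E,p)` is claimed; `q_d` and `c` are data (the twist's algebraic central value; the
Manin constant — ONLY `c ≠ 0` is assumed); per H46 every landed consumer of this currency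
(p255944 / p260907, tranche D) is a `p ≥ 5` statement. [cite: GrigorovJorzaPatrikisSteinTarnita2009, proof of Thm. 1.8 (p. 2398)]
[cite: JetchevSkinnerWan2017, §7.4.1 (eq:gz for K′)] -/
theorem exists_shaAn_eq_mul_sq
    (W : WeierstrassCurve ℚ) [W.IsElliptic] [W.IsGloballyMinimal]
    (N : ℕ) [NeZero N] (K : Type) [Field K] [NumberField K]
    (Dt : ModularParametrizationData W N) (H : HeegnerDatum N (NumberField.discr K)) (ι : K →+* ℂ)
    (P : (W.baseChange K).toAffine.Point)
    (hGZ : gross_zagier N W K) (hKo : kolyvagin N W K)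
    (hGZK : rank_eq_analyticRank_of_analyticRank_le_one) (hmod : hasEntireLFunction_rat)
    (hK : IsImaginaryQuadratic K) (hHN : SatisfiesHeegnerHypothesis N K)
    (hP : WeierstrassCurve.Affine.Point.map ι.toRatAlgHom P = heegnerPointComplex Dt H)
    (hc : Dt.c ≠ 0) (hr : W.analyticRank = 1)
    (hLt : (W.quadraticTwist (NumberField.discr K : ℚ)).entireLFunction 1 ≠ 0)
    (Wd : WeierstrassCurve ℚ) [Wd.IsElliptic] [Wd.IsGloballyMinimal] (Cd : VariableChange ℚ)
    (hWd : Cd • W.quadraticTwist (NumberField.discr K : ℚ) = Wd)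
    (qd : ℚ) (hqd : Wd.entireLFunction 1 / (Wd.realPeriodRat : ℂ) = (qd : ℂ)) :
    ∃ (m : ℕ) (R : ℚ) (I : ℤ), (m = 1 ∨ m = 4) ∧ I = ((AddSubgroup.zmultiples P).index : ℤ) ∧
      R = 8 * (W.torsionOrder : ℚ) ^ 2 /
        (((W.baseChange ℝ).numRealComponents : ℚ) * (m : ℚ) * ((W.baseChange K).torsionOrder : ℚ) ^ 2 *
          (Dt.c : ℚ) ^ 2 * (Units.torsionOrder K : ℚ) ^ 2 * qd * |(Cd.u : ℚ)| *
          (W.tamagawaProduct : ℚ)) ∧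
      shaAn W = ((R * (I : ℚ) ^ 2 : ℚ) : ℂ) ∧
      R.den ∣ (W.baseChange ℝ).numRealComponents * 4 * (W.baseChange K).torsionOrder ^ 2 *
        (Dt.c).natAbs ^ 2 * Units.torsionOrder K ^ 2 * qd.num.natAbs * (Cd.u : ℚ).num.natAbs *
        W.tamagawaProduct := by
  haveI hEK : (W.baseChange K).IsElliptic := isElliptic_baseChange' W K
  obtain ⟨m, hm, h⟩ := exists_shaAn_eq_mul_index_sq W N K Dt H ι P hGZ hKo hGZK hmod hK hHN hP hc
    hr hLt Wd Cd hWd qd hqd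
  -- `q_d ≠ 0` (the twist's `L`-value is non-zero) and the other non-vanishings
  have hD0 : (NumberField.discr K : ℚ) ≠ 0 := by exact_mod_cast NumberField.discr_ne_zero K
  haveI hEt : (W.quadraticTwist (NumberField.discr K : ℚ)).IsElliptic :=
    W.isElliptic_quadraticTwist hD0
  have hLt' : (W.quadraticTwist (NumberField.discr K : ℚ)).entireLFunction = Wd.entireLFunction := by
    rw [← hWd, entireLFunction_smul]
  have hqd0 : qd ≠ 0 := by
    intro h0
    have hΩdC : (Wd.realPeriodRat : ℂ) ≠ 0 := by exact_mod_cast Wd.realPeriodRat_pos_holds.ne'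
    have := (div_eq_iff hΩdC).mp hqd
    rw [h0] at this
    apply hLt
    rw [hLt', this]; simp
  have hn : (W.baseChange ℝ).numRealComponents ≠ 0 := by
    rcases numRealComponents_eq_one_or W with h' | h' <;> omega
  refine ⟨m, _, ((AddSubgroup.zmultiples P).index : ℤ), hm, rfl, rfl, ?_, ?_⟩
  · rw [h]
    push_cast
    ring_nf
  · exact den_dvd_of_gzShape hm hn (W.baseChange K).torsionOrder_pos_holds.ne' hc
      (Units.torsionOrder_pos K).ne' W.tamagawaProduct_pos_holds.ne' hqd0 Cd.u.ne_zero

end Summit.BirchSwinnertonDyer.Rank1Residual.X11b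

end
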